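import Literature.Analysis.FluidPDE.TaoPressureIsNormalised
import Literature.Analysis.FluidPDE.ClassicalSolutionGlue
import Literature.Analysis.FluidPDE.SobolevWholeSpace
import HarnessLib

/-!
# Transfer of pressure norms to a Tao patch: Stein and Sobolev bounds for the patch pressure

Analysis/FluidPDE proof file (theorems only: no definition, no named fact, no `sorry`).
Search for candidate a priori estimates; no regularity claim. In the assembly of the pressure
regularity criterion `Literature.Analysis.FluidPDE.pressureGradientCriterion` (Lemarié-Rieusset 2016,
§11.5 Prop. 11.7, case `1 < q < 3`) the `L⁴` Grönwall inequality
(`Literature.Analysis.FluidPDE.lfour_energy_le_mul_exp`) is applied on classical patches `(w, π)` of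
Tao's `L²`-Sobolev class which represent the given Leray–Hopf/classical solution `(u, p)` on a
time window: `u(t + τ₁) = w(t)`. Its two pressure hypotheses are supplied here, for a.e. patch
time `t`:

* Stein's bound `‖π(t)‖_{L^m} ≤ C_S ‖w(t)‖²_{L^{2m}}` — because `π(t)` IS the normalised pressure of
  `w(t)` for a.e. `t` (`ae_pressure_eq_normalisedPressure`, Tao 2013 Lemma 4.1 (i) + `L²`) and
  `w(t) ∈ L² ∩ L^∞ ⊂ L^{2m}`;
* the Sobolev bound `‖π(t)‖_{L^r} ≤ K_q ‖∇p(t + τ₁)‖_{L^q}`, `1/r = 1/q - 1/3`, `1 < q < 3` — the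
  Gagliardo–Nirenberg–Sobolev inequality for functions in `L^q` with gradient in `L^q`
  (`eLpNorm_le_eLpNorm_fderiv_of_eq_of_eLpNorm_lt_top`; `π(t) ∈ L^q` by Stein at exponent `q`),
  and `∇π(t) = ∇p(t + τ₁)` because the two classical solutions have the same velocity near `t`
  (`IsClassicalNSSolutionOn.gradient_pressure_eq_of_eventuallyEq`).

## References

* [LemarieRieusset2016] P. G. Lemarié-Rieusset, *The Navier–Stokes problem in the 21st century*,
  CRC Press 2016 — §11.5, Prop. 11.7 proof (PDF pp. 362–364): `‖ϖ‖_{σ/2} ≤ C‖u‖_σ²` (Riesz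
  transforms) and the case `1 < q < 3` reduced to `ϖ ∈ L^p_t L^r_x` by Sobolev embedding.
* [Tao2011] T. Tao, *Localisation and compactness properties of the Navier–Stokes global
  regularity problem*, Anal. PDE 6 (2013) — Lemma 4.1 (i).
-/

noncomputable section

open MeasureTheory Set Function Filter Topology
open scoped ENNReal NNReal ContDiff

namespace Literature.Analysis.FluidPDE

/-- **`L^∞ ∩ L² ⊂ L^P` for slices**: a continuous field `v : ℝ³ → ℝ³` with `‖v‖ ≤ B` and
`∫‖v‖² < ∞` lies in `L^P` for every `2 ≤ P < ∞` (`∫‖v‖^P ≤ B^{P-2}∫‖v‖²`). [folklore] -/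
private theorem memLp_of_norm_le_of_lintegral_sq_lt_top
    {v : EuclideanSpace ℝ (Fin 3) → EuclideanSpace ℝ (Fin 3)} (hv : Continuous v) {B : ℝ}
    (hB : ∀ x, ‖v x‖ ≤ B) (hv2 : ∫⁻ x, ‖v x‖ₑ ^ 2 < ⊤) {P : ℝ≥0∞} (h2P : 2 ≤ P) (hPtop : P ≠ ⊤) :
    MemLp v P volume := by
  have hP0 : P ≠ 0 := (lt_of_lt_of_le (by norm_num) h2P).ne'
  have hP2 : 2 ≤ P.toReal := by
    have h := ENNReal.toReal_mono hPtop h2P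
    simpa using h
  refine ⟨hv.aestronglyMeasurable, ?_⟩
  rw [eLpNorm_lt_top_iff_lintegral_rpow_enorm_lt_top hP0 hPtop]
  have hpt : ∀ x, ‖v x‖ₑ ^ P.toReal ≤ ENNReal.ofReal B ^ (P.toReal - 2) * ‖v x‖ₑ ^ 2 := by
    intro x
    have hsplit : ‖v x‖ₑ ^ P.toReal = ‖v x‖ₑ ^ (P.toReal - 2) * ‖v x‖ₑ ^ (2 : ℝ) := by
      rw [← ENNReal.rpow_add_of_nonneg _ _ (by linarith) (by norm_num)]
      congr 1; ring
    rw [hsplit, ENNReal.rpow_two]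
    refine mul_le_mul_left (ENNReal.rpow_le_rpow ?_ (by linarith)) _
    rw [← ofReal_norm]
    exact ENNReal.ofReal_le_ofReal (hB x)
  calc ∫⁻ x, ‖v x‖ₑ ^ P.toReal ≤ ∫⁻ x, ENNReal.ofReal B ^ (P.toReal - 2) * ‖v x‖ₑ ^ 2 :=
        lintegral_mono hpt
    _ = ENNReal.ofReal B ^ (P.toReal - 2) * ∫⁻ x, ‖v x‖ₑ ^ 2 :=
        lintegral_const_mul' _ _ (ENNReal.rpow_ne_top_of_nonneg (by linarith) ENNReal.ofReal_ne_top)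
    _ < ⊤ := ENNReal.mul_lt_top
        (ENNReal.rpow_lt_top_of_nonneg (by linarith) ENNReal.ofReal_ne_top) hv2

/-- **The patch pressure gradient is the reference pressure gradient.** If `(w, π)` is a
classical solution on `[0, L]` and `(u, p)` one on a time set `S` with `u(t + τ₁) = w(t)` for
`t ∈ (0, L')`, `L' ≤ L`, and `(0, L') + τ₁ ⊆ S`, then `∇π(t) = ∇p(t + τ₁)` for `t ∈ (0, L')` (same velocity
near `t`, subtract the momentum equations). [folklore] -/
private theorem gradient_patch_pressure_eq {ν L : ℝ}
    {w : ℝ → EuclideanSpace ℝ (Fin 3) → EuclideanSpace ℝ (Fin 3)}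
    {π : ℝ → EuclideanSpace ℝ (Fin 3) → ℝ} (hw : FluidPDE.IsClassicalNSSolutionOn (Icc 0 L) ν 0 w π)
    {S : Set ℝ} {u : ℝ → EuclideanSpace ℝ (Fin 3) → EuclideanSpace ℝ (Fin 3)}
    {p : ℝ → EuclideanSpace ℝ (Fin 3) → ℝ} (hcl : FluidPDE.IsClassicalNSSolutionOn S ν 0 u p)
    {τ₁ L' : ℝ} (hL' : L' ≤ L) (hS : ∀ t ∈ Ioo 0 L', t + τ₁ ∈ S)
    (heq : ∀ t ∈ Ioo 0 L', u (t + τ₁) = w t)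
    {t : ℝ} (ht : t ∈ Ioo 0 L') : gradient (π t) = gradient (p (t + τ₁)) := by
  have h₂ := hcl.comp_add_right τ₁
  have h0 : (fun s => (0 : ℝ → EuclideanSpace ℝ (Fin 3) → EuclideanSpace ℝ (Fin 3)) (s + τ₁)) = 0 :=
    rfl
  rw [h0] at h₂
  have hnhds : Ioo 0 L' ∈ 𝓝 t := Ioo_mem_nhds ht.1 ht.2
  have hS₁ : Icc 0 L ∈ 𝓝 t := Icc_mem_nhds ht.1 (lt_of_lt_of_le ht.2 hL')
  have hS₂ : (fun s => s + τ₁) ⁻¹' S ∈ 𝓝 t :=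
    Filter.mem_of_superset hnhds fun s hs => hS s hs
  have hev : ∀ᶠ s in 𝓝 t, w s = (fun s => u (s + τ₁)) s :=
    Filter.eventually_of_mem hnhds fun s hs => (heq s hs).symm
  funext x
  exact hw.gradient_pressure_eq_of_eventuallyEq h₂ hS₁ hS₂ hev x

/-- **Pressure norms on a Tao patch, on a sub-window** (the two pressure hypotheses of the `L⁴` Grönwall
inequality `lfour_energy_le_mul_exp`, supplied from the data). Let `(w, π)` be a classical
solution of the unforced Navier–Stokes system on `[0, L] × ℝ³` (`ν > 0`) in Tao's `L²`-Sobolev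
class (velocity with all `L²` Sobolev norms bounded, pressure slices square integrable), which
represents a classical solution `(u, p)` on a time set `S` on a window `(0, L')`, `L' ≤ L`:
`u(t + τ₁) = w(t)` for `t ∈ (0, L')`, `(0, L') + τ₁ ⊆ S`. Let `1 < m < ∞` with Stein's constant `C_S`
(`‖ϖ[v]‖_{L^m} ≤ C_S‖v‖²_{L^{2m}}`), and `1 < q < 3`, `r` with `1/r = 1/q - 1/3`. Then for a.e.
`t ∈ (0, L)`:
`‖π(t)‖_{L^m} ≤ C_S ‖w(t)‖²_{L^{2m}}` and `‖π(t)‖_{L^r} ≤ K_q ‖∇p(t + τ₁)‖_{L^q}`,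
`K_q` Mathlib's Gagliardo–Nirenberg–Sobolev constant for real functions on `ℝ³` (a.e. `t ∈ (0, L')`).
[cite: LemarieRieusset2016, §11.5 Prop. 11.7 proof (PDF pp. 362–364)] [cite: Tao2011, Lemma 4.1 (i)] -/
theorem ae_patch_pressure_bounds_of_le {ν L : ℝ} (hν : 0 < ν) (hL : 0 < L)
    {w : ℝ → EuclideanSpace ℝ (Fin 3) → EuclideanSpace ℝ (Fin 3)}
    {π : ℝ → EuclideanSpace ℝ (Fin 3) → ℝ} (hw : FluidPDE.IsClassicalNSSolutionOn (Icc 0 L) ν 0 w π)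
    (hbw : HasBoundedSobolevNormsOn (Icc 0 L) w)
    (hbπ : ∃ C : ℝ≥0, ∀ t ∈ Icc 0 L, ∫⁻ x, ‖iteratedFDeriv ℝ 0 (π t) x‖ₑ ^ 2 ≤ C)
    {S : Set ℝ} {u : ℝ → EuclideanSpace ℝ (Fin 3) → EuclideanSpace ℝ (Fin 3)}
    {p : ℝ → EuclideanSpace ℝ (Fin 3) → ℝ} (hcl : FluidPDE.IsClassicalNSSolutionOn S ν 0 u p)
    {τ₁ L' : ℝ} (hL' : L' ≤ L) (hS : ∀ t ∈ Ioo 0 L', t + τ₁ ∈ S)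
    (heq : ∀ t ∈ Ioo 0 L', u (t + τ₁) = w t)
    {m : ℝ≥0∞} (h1m : 1 < m) (hmtop : m < ⊤) {CS : ℝ≥0}
    (hCS : ∀ v : EuclideanSpace ℝ (Fin 3) → EuclideanSpace ℝ (Fin 3), MemLp v (2 * m) volume →
      eLpNorm (normalisedPressure v) m volume ≤ CS * eLpNorm v (2 * m) volume ^ 2)
    {q r : ℝ≥0∞} (h1q : 1 < q) (hq3 : q < 3) (hrtop : r ≠ ⊤)
    (hqr : (r.toReal)⁻¹ = (q.toReal)⁻¹ - 3⁻¹) :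
    ∀ᵐ t ∂volume, t ∈ Ioo 0 L' →
      eLpNorm (π t) m volume ≤ CS * eLpNorm (w t) (2 * m) volume ^ 2 ∧
      eLpNorm (π t) r volume ≤
        (SNormLESNormFDerivOfEqConst ℝ (volume : Measure (EuclideanSpace ℝ (Fin 3))) q.toReal :
          ℝ≥0∞) * eLpNorm (fun x => gradient (p (t + τ₁)) x) q volume := by
  have hqtop : q ≠ ⊤ := (hq3.trans (by simp : (3 : ℝ≥0∞) < ⊤)).ne
  have hq1r : 1 ≤ q.toNNReal := by
    have h : (1 : ℝ≥0∞).toNNReal ≤ q.toNNReal := ENNReal.toNNReal_mono hqtop h1q.le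
    simpa using h
  -- `π t = ϖ[w t]` for a.e. `t ∈ [0, L]`
  have hae := ae_pressure_eq_normalisedPressure hν hL hw hbw hbπ
  rw [ae_restrict_iff' measurableSet_Icc] at hae
  -- velocity bounds
  obtain ⟨B₀, hB₀⟩ := linfty_bound_of_hasBoundedSobolevNormsOn_holds
    (fun t ht => (hw.contDiff_velocity ht).of_le (by norm_cast)) hbw
  obtain ⟨C₀, hC₀⟩ := hbw 0
  have hzero : ∀ {f : EuclideanSpace ℝ (Fin 3) → EuclideanSpace ℝ (Fin 3)} {C' : ℝ≥0},
      (∫⁻ x, ‖iteratedFDeriv ℝ 0 f x‖ₑ ^ 2 ≤ C') → ∫⁻ x, ‖f x‖ₑ ^ 2 < ⊤ := by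
    intro f C' h
    refine lt_of_le_of_lt ((le_of_eq (lintegral_congr fun x => ?_)).trans h) ENNReal.coe_lt_top
    rw [← ofReal_norm, ← ofReal_norm, norm_iteratedFDeriv_zero]
  filter_upwards [hae] with t ht htI
  have htc : t ∈ Icc 0 L := ⟨htI.1.le, htI.2.le.trans hL'⟩
  have hπeq : π t = normalisedPressure (w t) := ht htc
  have cw : Continuous (w t) := (hw.contDiff_velocity htc).continuous
  have hw2 : ∫⁻ x, ‖w t x‖ₑ ^ 2 < ⊤ := hzero (hC₀ t htc)
  have hwP : ∀ {P : ℝ≥0∞}, 2 ≤ P → P ≠ ⊤ → MemLp (w t) P volume := fun h2P hPtop =>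
    memLp_of_norm_le_of_lintegral_sq_lt_top cw (hB₀ t htc) hw2 h2P hPtop
  refine ⟨?_, ?_⟩
  · -- Stein
    have h2m : 2 ≤ 2 * m := by
      calc (2 : ℝ≥0∞) = 2 * 1 := (mul_one _).symm
        _ ≤ 2 * m := by gcongr
    have h := hCS (w t) (hwP h2m (ENNReal.mul_ne_top (by simp) hmtop.ne))
    rwa [← hπeq] at h
  · -- Sobolev
    have h2q : 2 ≤ 2 * q := by
      calc (2 : ℝ≥0∞) = 2 * 1 := (mul_one _).symm
        _ ≤ 2 * q := by gcongr
    have hπq : MemLp (π t) q volume := by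
      rw [hπeq]
      exact memLp_normalisedPressure_of_memLp_two_mul h1q (lt_top_iff_ne_top.2 hqtop)
        (hwP h2q (ENNReal.mul_ne_top (by simp) hqtop))
    have hπ1 : ContDiff ℝ 1 (π t) := (hw.contDiff_pressure htc).of_le (by norm_cast)
    have hqcoe : ((q.toNNReal : ℝ≥0) : ℝ≥0∞) = q := ENNReal.coe_toNNReal hqtop
    have hrcoe : ((r.toNNReal : ℝ≥0) : ℝ≥0∞) = r := ENNReal.coe_toNNReal hrtop
    have hqr' : ((r.toNNReal : ℝ≥0) : ℝ)⁻¹ = ((q.toNNReal : ℝ≥0) : ℝ)⁻¹ -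
        (Module.finrank ℝ (EuclideanSpace ℝ (Fin 3)) : ℝ)⁻¹ := by
      rw [finrank_euclideanSpace_fin]
      push_cast
      exact hqr
    have hGNS := eLpNorm_le_eLpNorm_fderiv_of_eq_of_eLpNorm_lt_top
      (volume : Measure (EuclideanSpace ℝ (Fin 3))) (F := ℝ) hπ1 (p := q.toNNReal)
      (p' := r.toNNReal) hq1r (by rw [finrank_euclideanSpace_fin]; norm_num) hqr'
      (by rw [hqcoe]; exact hπq.eLpNorm_lt_top)
    rw [hqcoe, hrcoe] at hGNS
    have hgrad : eLpNorm (fderiv ℝ (π t)) q volume =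
        eLpNorm (fun x => gradient (p (t + τ₁)) x) q volume := by
      rw [← gradient_patch_pressure_eq hw hcl hL' hS heq htI]
      refine eLpNorm_congr_norm_ae (Eventually.of_forall fun x => ?_)
      rw [gradient, LinearIsometryEquiv.norm_map]
    have hK : ((q.toNNReal : ℝ≥0) : ℝ) = q.toReal := rfl
    rw [hgrad, hK] at hGNS
    exact hGNS

/-- **Pressure norms on a Tao patch** (full window `L' = L`): for a classical solution `(w, π)`
on `[0, L] × ℝ³` in Tao's class representing `(u, p)` on `(0, L)` (`u(t + τ₁) = w(t)`), for a.e.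
`t ∈ (0, L)`: `‖π(t)‖_{L^m} ≤ C_S ‖w(t)‖²_{L^{2m}}` and `‖π(t)‖_{L^r} ≤ K_q ‖∇p(t + τ₁)‖_{L^q}`.
[cite: LemarieRieusset2016, §11.5 Prop. 11.7 proof (PDF pp. 362–364)] [cite: Tao2011, Lemma 4.1 (i)] -/
theorem ae_patch_pressure_bounds {ν L : ℝ} (hν : 0 < ν) (hL : 0 < L)
    {w : ℝ → EuclideanSpace ℝ (Fin 3) → EuclideanSpace ℝ (Fin 3)}
    {π : ℝ → EuclideanSpace ℝ (Fin 3) → ℝ} (hw : FluidPDE.IsClassicalNSSolutionOn (Icc 0 L) ν 0 w π)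
    (hbw : HasBoundedSobolevNormsOn (Icc 0 L) w)
    (hbπ : ∃ C : ℝ≥0, ∀ t ∈ Icc 0 L, ∫⁻ x, ‖iteratedFDeriv ℝ 0 (π t) x‖ₑ ^ 2 ≤ C)
    {S : Set ℝ} {u : ℝ → EuclideanSpace ℝ (Fin 3) → EuclideanSpace ℝ (Fin 3)}
    {p : ℝ → EuclideanSpace ℝ (Fin 3) → ℝ} (hcl : FluidPDE.IsClassicalNSSolutionOn S ν 0 u p)
    {τ₁ : ℝ} (hS : ∀ t ∈ Ioo 0 L, t + τ₁ ∈ S) (heq : ∀ t ∈ Ioo 0 L, u (t + τ₁) = w t)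
    {m : ℝ≥0∞} (h1m : 1 < m) (hmtop : m < ⊤) {CS : ℝ≥0}
    (hCS : ∀ v : EuclideanSpace ℝ (Fin 3) → EuclideanSpace ℝ (Fin 3), MemLp v (2 * m) volume →
      eLpNorm (normalisedPressure v) m volume ≤ CS * eLpNorm v (2 * m) volume ^ 2)
    {q r : ℝ≥0∞} (h1q : 1 < q) (hq3 : q < 3) (hrtop : r ≠ ⊤)
    (hqr : (r.toReal)⁻¹ = (q.toReal)⁻¹ - 3⁻¹) :
    ∀ᵐ t ∂volume, t ∈ Ioo 0 L →
      eLpNorm (π t) m volume ≤ CS * eLpNorm (w t) (2 * m) volume ^ 2 ∧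
      eLpNorm (π t) r volume ≤
        (SNormLESNormFDerivOfEqConst ℝ (volume : Measure (EuclideanSpace ℝ (Fin 3))) q.toReal :
          ℝ≥0∞) * eLpNorm (fun x => gradient (p (t + τ₁)) x) q volume :=
  ae_patch_pressure_bounds_of_le hν hL hw hbw hbπ hcl le_rfl hS heq h1m hmtop hCS h1q hq3 hrtop hqr

end Literature.Analysis.FluidPDE


end
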